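import Summits.CriticalPhenomena.SAWScalingLimit.Theses.SAWExcursionCardy
import Summits.CriticalPhenomena.SAWScalingLimit.Theorems.SAWExcursionCardyCardyFSpecSeries
import Summits.CriticalPhenomena.SAWScalingLimit.Theorems.SAWExcursionCardyCardyFSpecDeriv
import Summits.CriticalPhenomena.SAWScalingLimit.Theorems.SAWExcursionCardyCardyFSpecEuler
import HarnessLib

/-!
# `CardyFSpec` — the target function `F(u) = (8/5) u ₂F₁(-1/2, 2; 7/2; u)` of route
`SAWExcursionCardy` (item stmt-CriticalPhenomena-4516)

The support item `CardyFSpec` of the route fixes the normalisation of the conjectured scaling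
limit `F` of the SAW × random-walk-excursion non-intersection probability (the `κ = 8/3` member of
the family whose `κ = 2` member is Kozdron's `u(2-u)`, Kozdron 2009 / Lawler–Schramm–Werner 2003):

1. the ODE `2u²(1-u)F'' + u(3-u)F' - 3(1-u)F = 0` on `(0, 1)` (`cardyF_ode`) — from the
   hypergeometric equation of `w = ₂F₁(-1/2,2;7/2;·)` (helper file 2, `hyperg_ode`):
   with `F = (8/5)u w`, the left side is `(16/5)u²[u(1-u)w'' + (7/2 - 5u/2)w' + w]`;
2. `F(1) = 1` (`cardyF_one`) — Gauss's value `₂F₁(-1/2,2;7/2;1) = 5/8`, obtained in helper file 1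
   as a telescoping sum of the closed-form coefficients `c_n = -15(n+1)/((2n-1)(2n+1)(2n+3)(2n+5))`;
3. `F(u)/u → 8/5` as `u → 0⁺` (`tendsto_cardyF_div`) — continuity of `w` at `0`, `w(0) = 1`;
4. `F` strictly increasing on `[0, 1]` (`strictMonoOn_cardyF`) — helper file 1
   (`∑ (n+1)c_n = 0`, term-wise comparison), endpoint `u = 1` included;
5. Euler's integral `F(u) = 6u ∫₀¹ t√((1-t)(1-ut)) dt` on `[0, 1]` (`cardyF_eq_integral`) —
   helper file 3 on `[0, 1)` (term-wise integration of the binomial series), and at `u = 1`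
   directly: `6∫₀¹ t(1-t) dt = 1 = F(1)`.

The closing theorem is `cardyFSpec_proof : CardyFSpec`. Sources: Andrews–Askey–Roy (1999)
Thms 2.2.1, 2.2.2, eq. (2.3.5); the route text (Kozdron2007Fomin, LawlerSchrammWerner2003Restriction)
for the role of `F`. No definitions, no named-fact hypotheses.
-/

noncomputable section

open Filter Topology Set MeasureTheory intervalIntegral
open scoped Nat

namespace Summit.CriticalPhenomena.SAWScalingLimit.Theorems.CardyFSpec

/-! ### Derivatives of `F = (8/5) u w(u)` on `|u| < 1` -/

/-- `F'(x) = (8/5)(w(x) + x W₁(x))` on `|x| < 1` (product rule + `hasDerivAt_hyperg`). [folklore] -/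
theorem hasDerivAt_cardyF {x : ℝ} (hx : |x| < 1) :
    HasDerivAt (fun u : ℝ ↦ (8 / 5 : ℝ) * u * ₂F₁ (-1 / 2 : ℝ) (2 : ℝ) (7 / 2 : ℝ) u)
      ((8 / 5 : ℝ) * (₂F₁ (-1 / 2 : ℝ) 2 (7 / 2) x +
        x * ∑' n : ℕ, ordinaryHypergeometricCoefficient (-1 / 2 : ℝ) 2 (7 / 2) n *
          ((n : ℝ) * x ^ (n - 1)))) x := by
  have h1 : HasDerivAt (fun u : ℝ ↦ (8 / 5 : ℝ) * u) (8 / 5) x := by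
    simpa using (hasDerivAt_id x).const_mul (8 / 5 : ℝ)
  have h := h1.mul (hasDerivAt_hyperg hx)
  refine h.congr_deriv ?_
  ring

/-- On the open unit ball `deriv F = (8/5)(w + x W₁)`. [folklore] -/
theorem deriv_cardyF_eventuallyEq {x : ℝ} (hx : |x| < 1) :
    deriv (fun u : ℝ ↦ (8 / 5 : ℝ) * u * ₂F₁ (-1 / 2 : ℝ) (2 : ℝ) (7 / 2 : ℝ) u) =ᶠ[𝓝 x]
      fun y ↦ (8 / 5 : ℝ) * (₂F₁ (-1 / 2 : ℝ) 2 (7 / 2) y +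
        y * ∑' n : ℕ, ordinaryHypergeometricCoefficient (-1 / 2 : ℝ) 2 (7 / 2) n *
          ((n : ℝ) * y ^ (n - 1))) := by
  have hopen : ∀ᶠ y in 𝓝 x, |y| < 1 := (isOpen_Iio.preimage continuous_abs).mem_nhds hx
  filter_upwards [hopen] with y hy
  exact (hasDerivAt_cardyF hy).deriv

/-- `F''(x) = (8/5)(2 W₁(x) + x W₂(x))` on `|x| < 1`. [folklore] -/
theorem hasDerivAt_deriv_cardyF {x : ℝ} (hx : |x| < 1) :
    HasDerivAt (deriv (fun u : ℝ ↦ (8 / 5 : ℝ) * u * ₂F₁ (-1 / 2 : ℝ) (2 : ℝ) (7 / 2 : ℝ) u))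
      ((8 / 5 : ℝ) * (2 * (∑' n : ℕ, ordinaryHypergeometricCoefficient (-1 / 2 : ℝ) 2 (7 / 2) n *
          ((n : ℝ) * x ^ (n - 1))) +
        x * ∑' n : ℕ, ordinaryHypergeometricCoefficient (-1 / 2 : ℝ) 2 (7 / 2) n *
          ((n : ℝ) * (((n - 1 : ℕ) : ℝ) * x ^ (n - 1 - 1))))) x := by
  have h2 : HasDerivAt (fun y : ℝ ↦ y * ∑' n : ℕ,
      ordinaryHypergeometricCoefficient (-1 / 2 : ℝ) 2 (7 / 2) n * ((n : ℝ) * y ^ (n - 1)))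
      (1 * (∑' n : ℕ, ordinaryHypergeometricCoefficient (-1 / 2 : ℝ) 2 (7 / 2) n *
          ((n : ℝ) * x ^ (n - 1))) +
        x * ∑' n : ℕ, ordinaryHypergeometricCoefficient (-1 / 2 : ℝ) 2 (7 / 2) n *
          ((n : ℝ) * (((n - 1 : ℕ) : ℝ) * x ^ (n - 1 - 1)))) x :=
    (hasDerivAt_id x).mul (hasDerivAt_hypergDeriv hx)
  have h := ((hasDerivAt_hyperg hx).add h2).const_mul (8 / 5 : ℝ)
  refine (h.congr_of_eventuallyEq (deriv_cardyF_eventuallyEq hx)).congr_deriv ?_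
  ring

/-! ### The five conjuncts -/

/-- **(1) The ODE** `2u²(1-u)F'' + u(3-u)F' - 3(1-u)F = 0` on `(0, 1)`: with `F = (8/5) u w` the
left side is `(16/5) u² [u(1-u)W₂ + (7/2 - 5u/2)W₁ + w] = 0` by the hypergeometric equation
(`hyperg_ode`). [cite: AndrewsAskeyRoy1999, Thm 2.3.1] -/
theorem cardyF_ode {u : ℝ} (hu : u ∈ Set.Ioo (0 : ℝ) 1) :
    2 * u ^ 2 * (1 - u) *
        deriv (deriv (fun u : ℝ ↦ (8 / 5 : ℝ) * u * ₂F₁ (-1 / 2 : ℝ) (2 : ℝ) (7 / 2 : ℝ) u)) u +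
      u * (3 - u) * deriv (fun u : ℝ ↦ (8 / 5 : ℝ) * u * ₂F₁ (-1 / 2 : ℝ) (2 : ℝ) (7 / 2 : ℝ) u) u -
      3 * (1 - u) * ((8 / 5 : ℝ) * u * ₂F₁ (-1 / 2 : ℝ) (2 : ℝ) (7 / 2 : ℝ) u) = 0 := by
  have hu1 : |u| < 1 := abs_lt.2 ⟨by linarith [hu.1], hu.2⟩
  rw [(hasDerivAt_deriv_cardyF hu1).deriv, (hasDerivAt_cardyF hu1).deriv]
  have hode := hyperg_ode hu1
  linear_combination (16 / 5 * u ^ 2) * hode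

/-- **(2) `F(1) = 1`** (Gauss's value `₂F₁(-1/2, 2; 7/2; 1) = 5/8`, helper file 1).
[cite: AndrewsAskeyRoy1999, Thm 2.2.2] -/
theorem cardyF_one : (8 / 5 : ℝ) * 1 * ₂F₁ (-1 / 2 : ℝ) (2 : ℝ) (7 / 2 : ℝ) 1 = 1 := by
  rw [hyperg_one]
  norm_num

/-- **(3) `F(u)/u → 8/5` as `u → 0⁺`** (`F(u)/u = (8/5) w(u)` for `u ≠ 0`, `w` continuous at `0`,
`w(0) = 1`). [folklore] -/
theorem tendsto_cardyF_div :
    Tendsto (fun u : ℝ ↦ (8 / 5 : ℝ) * u * ₂F₁ (-1 / 2 : ℝ) (2 : ℝ) (7 / 2 : ℝ) u / u)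
      (𝓝[>] 0) (𝓝 (8 / 5 : ℝ)) := by
  have hcont : ContinuousAt (fun x : ℝ ↦ ₂F₁ (-1 / 2 : ℝ) 2 (7 / 2) x) (0 : ℝ) :=
    (hasDerivAt_hyperg (r := 0) (by simp)).continuousAt
  have h1 : Tendsto (fun u : ℝ ↦ (8 / 5 : ℝ) * ₂F₁ (-1 / 2 : ℝ) 2 (7 / 2) u) (𝓝[>] 0)
      (𝓝 ((8 / 5 : ℝ) * ₂F₁ (-1 / 2 : ℝ) 2 (7 / 2) (0 : ℝ))) :=
    (hcont.tendsto.const_mul (8 / 5 : ℝ)).mono_left nhdsWithin_le_nhds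
  rw [ordinaryHypergeometric_zero, mul_one] at h1
  refine h1.congr' ?_
  filter_upwards [self_mem_nhdsWithin] with u hu
  have hu0 : u ≠ 0 := ne_of_gt hu
  field_simp

/-- **(4) `F` is strictly increasing on `[0, 1]`** (helper file 1, `strictMonoOn_mul_hyperg`).
[folklore] -/
theorem strictMonoOn_cardyF :
    StrictMonoOn (fun u : ℝ ↦ (8 / 5 : ℝ) * u * ₂F₁ (-1 / 2 : ℝ) (2 : ℝ) (7 / 2 : ℝ) u)
      (Set.Icc 0 1) := by
  intro u hu v hv huv
  have h := strictMonoOn_mul_hyperg hu hv huv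
  simp only at h ⊢
  rw [mul_assoc, mul_assoc]
  exact mul_lt_mul_of_pos_left h (by norm_num)

/-- `∫₀¹ t√((1-t)(1-1·t)) dt = 1/6` (the Euler integrand at `u = 1` is `t(1-t)`). [folklore] -/
theorem integral_euler_one :
    ∫ t in (0 : ℝ)..1, t * Real.sqrt ((1 - t) * (1 - 1 * t)) = 1 / 6 := by
  have h1 : ∫ t in (0 : ℝ)..1, t * Real.sqrt ((1 - t) * (1 - 1 * t)) =
      ∫ t in (0 : ℝ)..1, (t - t ^ 2) := by
    refine intervalIntegral.integral_congr fun t ht ↦ ?_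
    rw [Set.uIcc_of_le zero_le_one] at ht
    have h : Real.sqrt ((1 - t) * (1 - 1 * t)) = 1 - t := by
      rw [one_mul, Real.sqrt_mul_self (by linarith [ht.2])]
    simp only [h]
    ring
  have hf : IntervalIntegrable (fun t : ℝ ↦ t) volume 0 1 := continuous_id'.intervalIntegrable 0 1
  have hg : IntervalIntegrable (fun t : ℝ ↦ t ^ 2) volume 0 1 :=
    (continuous_pow 2).intervalIntegrable 0 1
  rw [h1, intervalIntegral.integral_sub hf hg, integral_id, integral_pow]
  norm_num

/-- **(5) Euler's integral `F(u) = 6u ∫₀¹ t√((1-t)(1-ut)) dt` on `[0, 1]`** (helper file 3 on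
`[0, 1)`; at `u = 1` both sides equal `1`). [cite: AndrewsAskeyRoy1999, Thm 2.2.1] -/
theorem cardyF_eq_integral {u : ℝ} (hu : u ∈ Set.Icc (0 : ℝ) 1) :
    (8 / 5 : ℝ) * u * ₂F₁ (-1 / 2 : ℝ) (2 : ℝ) (7 / 2 : ℝ) u =
      6 * u * ∫ t in (0 : ℝ)..1, t * Real.sqrt ((1 - t) * (1 - u * t)) := by
  rcases hu.2.lt_or_eq with hlt | heq
  · rw [hyperg_eq_integral ⟨hu.1, hlt⟩]
    ring
  · subst heq
    rw [integral_euler_one, cardyF_one]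
    norm_num

/-! ### The item -/

/-- **Item `CardyFSpec` of route `SAWExcursionCardy` (stmt-CriticalPhenomena-4516)**: the target
function `F(u) = (8/5) u ₂F₁(-1/2, 2; 7/2; u)` solves `2u²(1-u)F'' + u(3-u)F' - 3(1-u)F = 0` on
`(0,1)`, `F(1) = 1`, `F(u)/u → 8/5` at `0⁺`, `F` is strictly increasing on `[0,1]`, and
`F(u) = 6u∫₀¹ t√((1-t)(1-ut)) dt` on `[0,1]`. [cite: AndrewsAskeyRoy1999, Thm 2.2.1] -/
theorem cardyFSpec_proof :
    Summit.CriticalPhenomena.SAWScalingLimit.Theses.SAWExcursionCardy.CardyFSpec := by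
  unfold Summit.CriticalPhenomena.SAWScalingLimit.Theses.SAWExcursionCardy.CardyFSpec
  dsimp only
  refine ⟨fun u hu ↦ cardyF_ode hu, cardyF_one, tendsto_cardyF_div, strictMonoOn_cardyF,
    fun u hu ↦ cardyF_eq_integral hu⟩

end Summit.CriticalPhenomena.SAWScalingLimit.Theorems.CardyFSpec
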